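import Mathlib.Analysis.Calculus.MeanValue
import Summits.AtomisticToContinuum.HydrodynamicLimit.Theorems.JParityClosureEvenStressEnskogClusterTransportKernel
import HarnessLib

/-!
# Cluster transport identity, II: the window observables along a free flight
# (helper file of `stub_clusterTransport`, line `stationary-microscale-hierarchy-entrance-law` of the
# crux `JParityClosure.EvenStressEnskog`, stmt-AtomisticToContinuum-13079)

Calculus of the Eulerian microscale window observables `winObs ε P z x₀ = Σ_ι P(tupleData ε z x₀ ι)`
and `streamObs ε P z x₀ = Σ_ι DP(tupleData)[(v_a, 0)_a]` of a compactly supported `C¹` tuple test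
function `P` of level `m` whose closed position support fits in the injectivity radius of `𝕋³`
(`ε‖ξ_a‖ ≤ ρ < 1/2` on `tsupport P`; the margin `ρ` exists by compactness,
`exists_tsupport_margin`):

* THE CHART ARGUMENT (`continuousAt_comp_chart`): a continuous function `Q` of the tuple data that
  is constant off `tsupport P` (e.g. `P`, `DP`) is continuous along any continuous motion of the
  positions — inside the injectivity radius the minimal image is continuous
  (`continuousAt_reprSym_of_norm_lt`), and as soon as ONE particle of the tuple is at distance
  `≥ 1/2 > ρ` from the centre the data leave `tsupport P` in a whole neighbourhood;
* consequences: `winObs`, `streamObs` are continuous in the centre (`continuous_winObs_centre`,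
  `continuous_streamObs_centre`) and along free flights (`continuous_streamObs_flight`), and
  `s ↦ winObs ε P (S_s w) x₀` is differentiable at EVERY time and EVERY centre with derivative
  `ε⁻¹ streamObs ε P (S_t w) x₀` (`hasDerivAt_winObs_flight`: in the chart the data are affine in
  `s` with velocity `(ε⁻¹ v_a, 0)_a`, `Torus.reprSym_add_proj_of_norm_lt`);
* sup bounds (`abs_winObs_le`, `abs_streamObs_le`) and the time-Lipschitz bound of `winObs` along a
  flight, uniform in the centre (`abs_winObs_flight_sub_le`).

References: H. Spohn, *Large Scale Dynamics of Interacting Particles* (1991), Part I §3.2.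
Elementary. [folklore]
-/

noncomputable section

open MeasureTheory Set Filter Function Metric
open scoped BigOperators Topology InnerProductSpace

namespace Summit.AtomisticToContinuum.HydrodynamicLimit.Theorems.EvenStressEnskog

open Literature.Analysis.FluidPDE Literature.Analysis.FunctionSpaces
  Literature.MathematicalPhysics.KineticTheory
  Literature.MathematicalPhysics.KineticTheory.StationaryMicroscale

/-! ## The support margin and sup bounds of the test function -/

/-- **The support margin**: a compactly supported tuple test function whose closed position support
fits in the injectivity radius (`ε‖ξ_a‖ < 1/2` on `tsupport P`) does so with a margin:
`ε‖ξ_a‖ ≤ ρ` on `tsupport P` for some `ρ < 1/2` (a continuous function attains its maximum on the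
compact set `tsupport P × Fin m`). [folklore] -/
theorem exists_tsupport_margin :
    ∀ {m : ℕ} (ε : ℝ) {P : (Fin m → V3 × V3) → ℝ}, HasCompactSupport P →
      (∀ q ∈ tsupport P, ∀ a, ε * ‖(q a).1‖ < 1 / 2) →
      ∃ ρ : ℝ, ρ < 1 / 2 ∧ ∀ q ∈ tsupport P, ∀ a, ε * ‖(q a).1‖ ≤ ρ := by
  intro m ε P hPc hsupp
  set K : Set ((Fin m → V3 × V3) × Fin m) := tsupport P ×ˢ univ with hK
  have hKc : IsCompact K := hPc.isCompact.prod isCompact_univ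
  set f : (Fin m → V3 × V3) × Fin m → ℝ := fun p => ε * ‖(p.1 p.2).1‖ with hf
  have hfc : Continuous f := by
    refine continuous_prod_of_discrete_right.2 fun a => ?_
    exact continuous_const.mul ((continuous_apply a).fst.norm)
  by_cases hne : K.Nonempty
  · obtain ⟨p₀, hp₀, hmax⟩ := hKc.exists_isMaxOn hne hfc.continuousOn
    refine ⟨f p₀, hsupp p₀.1 (mem_prod.1 hp₀).1 p₀.2, fun q hq a => ?_⟩
    exact (isMaxOn_iff.1 hmax) (q, a) (mem_prod.2 ⟨hq, mem_univ a⟩)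
  · refine ⟨0, by norm_num, fun q hq a => ?_⟩
    exact absurd ⟨(q, a), mem_prod.2 ⟨hq, mem_univ a⟩⟩ hne

/-- A compactly supported `C¹` function is bounded. [folklore] -/
theorem exists_bound_of_hasCompactSupport {m : ℕ} {P : (Fin m → V3 × V3) → ℝ}
    (hP : ContDiff ℝ 1 P) (hPc : HasCompactSupport P) : ∃ C : ℝ, 0 ≤ C ∧ ∀ q, |P q| ≤ C := by
  obtain ⟨C, hC⟩ := hPc.exists_bound_of_continuous hP.continuous
  exact ⟨max C 0, le_max_right _ _, fun q => (Real.norm_eq_abs _ ▸ hC q).trans (le_max_left _ _)⟩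

/-- The derivative of a compactly supported `C¹` function is bounded. [folklore] -/
theorem exists_bound_fderiv_of_hasCompactSupport {m : ℕ} {P : (Fin m → V3 × V3) → ℝ}
    (hP : ContDiff ℝ 1 P) (hPc : HasCompactSupport P) :
    ∃ C : ℝ, 0 ≤ C ∧ ∀ q, ‖fderiv ℝ P q‖ ≤ C := by
  obtain ⟨C, hC⟩ := (hPc.fderiv ℝ).exists_bound_of_continuous (hP.continuous_fderiv one_ne_zero)
  exact ⟨max C 0, le_max_right _ _, fun q => (hC q).trans (le_max_left _ _)⟩

/-! ## The chart argument -/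

/-- Data with ONE rescaled separation of norm `> ρ` lie off the closed support (`ε‖ξ_a‖ ≤ ρ` on
`tsupport P`). [folklore] -/
theorem not_mem_tsupport_of_lt_norm {m : ℕ} {ε ρ : ℝ} (hε : 0 < ε) {P : (Fin m → V3 × V3) → ℝ}
    (hmargin : ∀ q ∈ tsupport P, ∀ a, ε * ‖(q a).1‖ ≤ ρ) {X : Fin m → V3} {V : Fin m → V3}
    {a : Fin m} (ha : ρ < ‖X a‖) : (fun b => (ε⁻¹ • X b, V b)) ∉ tsupport P := by
  intro hmem
  have h := hmargin _ hmem a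
  simp only [norm_smul, norm_inv, Real.norm_eq_abs, abs_of_pos hε] at h
  rw [← mul_assoc, mul_inv_cancel₀ hε.ne', one_mul] at h
  exact (not_lt.2 h) ha

/-- **The chart argument.** Let `Q` be a continuous function of the tuple data, constant (`= Q₀`)
off `tsupport P`, and let the separations `X_a(y) ∈ 𝕋³` of the tuple from the centre move
continuously with a parameter `y`. Then `y ↦ Q((ε⁻¹ reprSym X_a(y), V_a)_a)` is continuous at
`y₀`: either every `X_a(y₀)` lies in the chart `‖reprSym‖ < 1/2`, where `reprSym` is continuous,
or one of them has `‖reprSym X_a(y₀)‖ ≥ 1/2 > ρ`, and then the data stay off `tsupport P` near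
`y₀`. [folklore] -/
theorem continuousAt_comp_chart {Y : Type*} [TopologicalSpace Y] {E' : Type*} [TopologicalSpace E']
    {m : ℕ} {ε ρ : ℝ} (hε : 0 < ε) (hρ : ρ < 1 / 2) {P : (Fin m → V3 × V3) → ℝ}
    (hmargin : ∀ q ∈ tsupport P, ∀ a, ε * ‖(q a).1‖ ≤ ρ) {Q : (Fin m → V3 × V3) → E'}
    (hQ : Continuous Q) {Q₀ : E'} (hQ0 : ∀ q ∉ tsupport P, Q q = Q₀) (X : Fin m → Y → T3)
    (V : Fin m → V3) {y₀ : Y} (hX : ∀ a, ContinuousAt (X a) y₀) :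
    ContinuousAt (fun y => Q (fun a => (ε⁻¹ • Torus.reprSym (X a y), V a))) y₀ := by
  by_cases h : ∀ a, ‖Torus.reprSym (X a y₀)‖ < 1 / 2
  · have hdata : ContinuousAt (fun y => fun a => (ε⁻¹ • Torus.reprSym (X a y), V a)) y₀ :=
      continuousAt_pi.2 fun a =>
        (((continuousAt_reprSym_of_norm_lt (h a)).comp (hX a)).const_smul ε⁻¹).prodMk
          continuousAt_const
    exact hQ.continuousAt.comp hdata
  · push Not at h
    obtain ⟨a, ha⟩ := h
    have hg : ContinuousAt (fun y => ‖Torus.reprSym (X a y)‖) y₀ :=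
      Torus.continuous_norm_reprSym.continuousAt.comp (hX a)
    have hev : ∀ᶠ y in 𝓝 y₀, ρ < ‖Torus.reprSym (X a y)‖ :=
      hg.eventually (Ioi_mem_nhds (hρ.trans_le ha))
    refine (continuousAt_const (y := Q₀)).congr ?_
    filter_upwards [hev] with y hy
    exact (hQ0 _ (not_mem_tsupport_of_lt_norm hε hmargin (X := fun b => Torus.reprSym (X b y))
      (V := V) (a := a) hy)).symm

/-- The tuple data unfold to the chart form. [folklore] -/
theorem tupleData_eq {N m : ℕ} (ε : ℝ) (z : Config (N + 1) (Fin 3) T3) (x₀ : T3)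
    (ι : Fin m ↪ Fin (N + 1)) :
    tupleData ε z x₀ ι = fun a => (ε⁻¹ • Torus.reprSym ((z (ι a)).1 - x₀), (z (ι a)).2) := rfl

/-- `streamObs` with the (configuration-only) velocity vector made explicit. [folklore] -/
theorem streamObs_eq {N m : ℕ} (ε : ℝ) (P : (Fin m → V3 × V3) → ℝ) (z : Config (N + 1) (Fin 3) T3)
    (x₀ : T3) :
    streamObs ε P z x₀ =
      ∑ ι : Fin m ↪ Fin (N + 1), (fderiv ℝ P (tupleData ε z x₀ ι)) (fun a => ((z (ι a)).2, 0)) :=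
  rfl

/-! ## Continuity in the centre -/

section Centre

variable {N m : ℕ} {ε ρ : ℝ} {P : (Fin m → V3 × V3) → ℝ}

/-- `x₀ ↦ P(tupleData ε z x₀ ι)` is continuous on `𝕋³`. [folklore] -/
theorem continuous_comp_tupleData_centre (hε : 0 < ε) (hρ : ρ < 1 / 2) (hP : ContDiff ℝ 1 P)
    (hmargin : ∀ q ∈ tsupport P, ∀ a, ε * ‖(q a).1‖ ≤ ρ) (z : Config (N + 1) (Fin 3) T3)
    (ι : Fin m ↪ Fin (N + 1)) : Continuous fun x₀ : T3 => P (tupleData ε z x₀ ι) := by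
  refine continuous_iff_continuousAt.2 fun x₀ => ?_
  simp only [tupleData_eq]
  exact continuousAt_comp_chart hε hρ hmargin hP.continuous
    (fun q hq => image_eq_zero_of_notMem_tsupport hq) (fun a x => (z (ι a)).1 - x)
    (fun a => (z (ι a)).2) fun a => (continuous_const.sub continuous_id).continuousAt

/-- `x₀ ↦ DP(tupleData ε z x₀ ι)` is continuous on `𝕋³`. [folklore] -/
theorem continuous_fderiv_comp_tupleData_centre (hε : 0 < ε) (hρ : ρ < 1 / 2)
    (hP : ContDiff ℝ 1 P) (hmargin : ∀ q ∈ tsupport P, ∀ a, ε * ‖(q a).1‖ ≤ ρ)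
    (z : Config (N + 1) (Fin 3) T3) (ι : Fin m ↪ Fin (N + 1)) :
    Continuous fun x₀ : T3 => fderiv ℝ P (tupleData ε z x₀ ι) := by
  refine continuous_iff_continuousAt.2 fun x₀ => ?_
  simp only [tupleData_eq]
  exact continuousAt_comp_chart hε hρ hmargin (hP.continuous_fderiv one_ne_zero)
    (fun q hq => fderiv_of_notMem_tsupport ℝ hq) (fun a x => (z (ι a)).1 - x)
    (fun a => (z (ι a)).2) fun a => (continuous_const.sub continuous_id).continuousAt

/-- **The window observable is continuous in the centre.** [folklore] -/
theorem continuous_winObs_centre (hε : 0 < ε) (hρ : ρ < 1 / 2) (hP : ContDiff ℝ 1 P)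
    (hmargin : ∀ q ∈ tsupport P, ∀ a, ε * ‖(q a).1‖ ≤ ρ) (z : Config (N + 1) (Fin 3) T3) :
    Continuous fun x₀ : T3 => winObs ε P z x₀ := by
  unfold winObs
  exact continuous_finsetSum _ fun ι _ => continuous_comp_tupleData_centre hε hρ hP hmargin z ι

/-- **The streaming observable is continuous in the centre.** [folklore] -/
theorem continuous_streamObs_centre (hε : 0 < ε) (hρ : ρ < 1 / 2) (hP : ContDiff ℝ 1 P)
    (hmargin : ∀ q ∈ tsupport P, ∀ a, ε * ‖(q a).1‖ ≤ ρ) (z : Config (N + 1) (Fin 3) T3) :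
    Continuous fun x₀ : T3 => streamObs ε P z x₀ := by
  simp only [streamObs_eq]
  exact continuous_finsetSum _ fun ι _ =>
    (continuous_fderiv_comp_tupleData_centre hε hρ hP hmargin z ι).clm_apply continuous_const

end Centre

/-! ## Along a free flight -/

section Flight

variable {N m : ℕ} {ε ρ : ℝ} {P : (Fin m → V3 × V3) → ℝ}

/-- `s ↦ DP(tupleData ε (S_s w) x₀ ι)` is continuous. [folklore] -/
theorem continuous_fderiv_comp_tupleData_flight (hε : 0 < ε) (hρ : ρ < 1 / 2)
    (hP : ContDiff ℝ 1 P) (hmargin : ∀ q ∈ tsupport P, ∀ a, ε * ‖(q a).1‖ ≤ ρ)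
    (w : Config (N + 1) (Fin 3) T3) (x₀ : T3) (ι : Fin m ↪ Fin (N + 1)) :
    Continuous fun s : ℝ =>
      fderiv ℝ P (tupleData ε (freeFlight (Torus.geometry (Fin 3)) s w) x₀ ι) := by
  refine continuous_iff_continuousAt.2 fun s => ?_
  simp only [tupleData_eq, freeFlight_apply, Torus.geometry_translate]
  refine continuousAt_comp_chart hε hρ hmargin (hP.continuous_fderiv one_ne_zero)
    (fun q hq => fderiv_of_notMem_tsupport ℝ hq)
    (fun a (s : ℝ) => (w (ι a)).1 + Torus.proj (s • (w (ι a)).2) - x₀) (fun a => (w (ι a)).2)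
    fun a => ?_
  exact ((continuous_const.add (Torus.continuous_proj.comp
    (continuous_id.smul continuous_const))).sub continuous_const).continuousAt

/-- **The streaming observable is continuous along a free flight**, at every centre. [folklore] -/
theorem continuous_streamObs_flight (hε : 0 < ε) (hρ : ρ < 1 / 2) (hP : ContDiff ℝ 1 P)
    (hmargin : ∀ q ∈ tsupport P, ∀ a, ε * ‖(q a).1‖ ≤ ρ) (w : Config (N + 1) (Fin 3) T3)
    (x₀ : T3) :
    Continuous fun s : ℝ => streamObs ε P (freeFlight (Torus.geometry (Fin 3)) s w) x₀ := by
  simp only [streamObs_eq, freeFlight_apply]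
  exact continuous_finsetSum _ fun ι _ =>
    (continuous_fderiv_comp_tupleData_flight hε hρ hP hmargin w x₀ ι).clm_apply continuous_const

/-- **The derivative of one tuple term along a flight, at time `0`.** For every centre,
`s ↦ P(tupleData ε (S_s w) x₀ ι)` is differentiable at `s = 0` with derivative
`ε⁻¹ DP(tupleData ε w x₀ ι)[(v_a, 0)_a]`: in the chart the data are affine in `s` with velocity
`(ε⁻¹ v_a, 0)_a`; off the chart the term and `DP(data)` vanish near `s = 0`. [folklore] -/
theorem hasDerivAt_comp_tupleData_flight_zero (hε : 0 < ε) (hρ : ρ < 1 / 2) (hP : ContDiff ℝ 1 P)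
    (hmargin : ∀ q ∈ tsupport P, ∀ a, ε * ‖(q a).1‖ ≤ ρ) (w : Config (N + 1) (Fin 3) T3)
    (x₀ : T3) (ι : Fin m ↪ Fin (N + 1)) :
    HasDerivAt (fun s : ℝ => P (tupleData ε (freeFlight (Torus.geometry (Fin 3)) s w) x₀ ι))
      (ε⁻¹ * (fderiv ℝ P (tupleData ε w x₀ ι)) (fun a => ((w (ι a)).2, 0))) 0 := by
  simp only [tupleData_eq, freeFlight_apply, Torus.geometry_translate]
  by_cases h : ∀ a, Torus.euclidDist (w (ι a)).1 x₀ < 1 / 2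
  · -- in the chart: the data are affine in `s`
    set q₀ : Fin m → V3 × V3 := fun a => (ε⁻¹ • Torus.reprSym ((w (ι a)).1 - x₀), (w (ι a)).2)
      with hq₀
    set D : Fin m → V3 × V3 := fun a => (ε⁻¹ • (w (ι a)).2, 0) with hD
    have hev : ∀ᶠ s : ℝ in 𝓝 0,
        (fun a => (ε⁻¹ • Torus.reprSym ((w (ι a)).1 + Torus.proj (s • (w (ι a)).2) - x₀),
          (w (ι a)).2)) = q₀ + s • D := by
      have hall : ∀ᶠ s : ℝ in 𝓝 0, ∀ a, Torus.reprSym ((w (ι a)).1 +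
          Torus.proj (s • (w (ι a)).2) - x₀) = Torus.reprSym ((w (ι a)).1 - x₀) + s • (w (ι a)).2 :=
        eventually_all.2 fun a => reprSym_flight_eventuallyEq (w (ι a)).2 (h a)
      filter_upwards [hall] with s hs
      funext a
      rw [hs a, Pi.add_apply, Pi.smul_apply, hq₀, hD]
      simp only [Prod.smul_mk, Prod.mk_add_mk, smul_add, smul_zero, add_zero, smul_smul, mul_comm]
    have hL : HasDerivAt (fun s : ℝ => q₀ + s • D) D 0 := by
      simpa using ((hasDerivAt_id (0 : ℝ)).smul_const D).const_add q₀
    have hPd : HasFDerivAt P (fderiv ℝ P q₀) (q₀ + (0 : ℝ) • D) := by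
      rw [zero_smul, add_zero]
      exact ((hP.differentiable one_ne_zero) q₀).hasFDerivAt
    have hcomp := hPd.comp_hasDerivAt (0 : ℝ) hL
    have hval : (fderiv ℝ P q₀) D = ε⁻¹ * (fderiv ℝ P q₀) (fun a => ((w (ι a)).2, 0)) := by
      have hDe : D = ε⁻¹ • (fun a => ((w (ι a)).2, (0 : V3))) := by
        funext a
        simp [hD]
      rw [hDe, map_smul, smul_eq_mul]
    rw [← hval]
    exact hcomp.congr_of_eventuallyEq (hev.mono fun s hs => by rw [Function.comp_apply, ← hs])
  · -- off the chart: the term vanishes near `s = 0`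
    push Not at h
    obtain ⟨a, ha⟩ := h
    have hρa : ρ < Torus.euclidDist (w (ι a)).1 x₀ := hρ.trans_le ha
    have hcont := continuous_euclidDist_flight (w (ι a)).1 x₀ (w (ι a)).2
    have hev : ∀ᶠ s : ℝ in 𝓝 0, ρ < Torus.euclidDist ((w (ι a)).1 + Torus.proj (s • (w (ι a)).2)) x₀ := by
      have := hcont.tendsto 0
      simp only [zero_smul, Torus.proj_zero, add_zero] at this
      exact this.eventually (Ioi_mem_nhds hρa)
    have h0 : (fun b => (ε⁻¹ • Torus.reprSym ((w (ι b)).1 - x₀), (w (ι b)).2)) ∉ tsupport P :=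
      not_mem_tsupport_of_lt_norm hε hmargin (X := fun b => Torus.reprSym ((w (ι b)).1 - x₀))
        (V := fun b => (w (ι b)).2) (a := a) hρa
    rw [fderiv_of_notMem_tsupport ℝ h0, zero_apply, mul_zero]
    refine (hasDerivAt_const (0 : ℝ) (0 : ℝ)).congr_of_eventuallyEq ?_
    filter_upwards [hev] with s hs
    exact image_eq_zero_of_notMem_tsupport
      (not_mem_tsupport_of_lt_norm hε hmargin
        (X := fun b => Torus.reprSym ((w (ι b)).1 + Torus.proj (s • (w (ι b)).2) - x₀))
        (V := fun b => (w (ι b)).2) (a := a) hs)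

/-- **The window observable along a free flight**: for EVERY centre and every time `t`,
`s ↦ winObs ε P (S_s w) x₀` has the derivative `ε⁻¹ streamObs ε P (S_t w) x₀` at `s = t`.
[folklore] -/
theorem hasDerivAt_winObs_flight (hε : 0 < ε) (hρ : ρ < 1 / 2) (hP : ContDiff ℝ 1 P)
    (hmargin : ∀ q ∈ tsupport P, ∀ a, ε * ‖(q a).1‖ ≤ ρ) (w : Config (N + 1) (Fin 3) T3)
    (x₀ : T3) (t : ℝ) :
    HasDerivAt (fun s : ℝ => winObs ε P (freeFlight (Torus.geometry (Fin 3)) s w) x₀)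
      (ε⁻¹ * streamObs ε P (freeFlight (Torus.geometry (Fin 3)) t w) x₀) t := by
  -- at time `0` for the configuration `S_t w`, then shift
  have h0 : HasDerivAt (fun s : ℝ => winObs ε P (freeFlight (Torus.geometry (Fin 3)) s
      (freeFlight (Torus.geometry (Fin 3)) t w)) x₀)
      (ε⁻¹ * streamObs ε P (freeFlight (Torus.geometry (Fin 3)) t w) x₀) 0 := by
    unfold winObs
    rw [streamObs_eq, Finset.mul_sum]
    exact HasDerivAt.fun_sum (u := Finset.univ) fun ι _ =>
      hasDerivAt_comp_tupleData_flight_zero hε hρ hP hmargin _ x₀ ι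
  simp only [← freeFlight_add] at h0
  have h0' : HasDerivAt (fun s : ℝ => winObs ε P (freeFlight (Torus.geometry (Fin 3)) (s + t) w) x₀)
      (ε⁻¹ * streamObs ε P (freeFlight (Torus.geometry (Fin 3)) t w) x₀) (t - t) := by
    rwa [sub_self]
  simpa only [sub_add_cancel] using h0'.comp_sub_const t t

end Flight

/-! ## Sup bounds and the time-Lipschitz bound -/

section Bounds

variable {N m : ℕ} {ε ρ : ℝ} {P : (Fin m → V3 × V3) → ℝ}

/-- `|winObs ε P z x₀| ≤ #{ι} · sup |P|`. [folklore] -/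
theorem abs_winObs_le {C : ℝ} (hC : ∀ q, |P q| ≤ C) (ε : ℝ) (z : Config (N + 1) (Fin 3) T3)
    (x₀ : T3) : |winObs ε P z x₀| ≤ Fintype.card (Fin m ↪ Fin (N + 1)) * C := by
  unfold winObs
  refine (Finset.abs_sum_le_sum_abs _ _).trans ?_
  refine (Finset.sum_le_sum fun ι _ => hC _).trans ?_
  rw [Finset.sum_const, Finset.card_univ, nsmul_eq_mul]

/-- The velocity vector `(v_{ιa}, 0)_a` of a tuple has sup norm at most `Σ_k ‖v_k‖`. [folklore] -/
theorem norm_tupleVel_le (z : Config (N + 1) (Fin 3) T3) (ι : Fin m ↪ Fin (N + 1)) :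
    ‖(fun a => ((z (ι a)).2, (0 : V3)))‖ ≤ ∑ k, ‖(z k).2‖ := by
  refine (pi_norm_le_iff_of_nonneg (Finset.sum_nonneg fun k _ => norm_nonneg _)).2 fun a => ?_
  rw [Prod.norm_mk, norm_zero, max_eq_left (norm_nonneg _)]
  exact Finset.single_le_sum (f := fun k => ‖(z k).2‖) (fun k _ => norm_nonneg _)
    (Finset.mem_univ (ι a))

/-- `|streamObs ε P z x₀| ≤ #{ι} · sup ‖DP‖ · Σ_k ‖v_k‖`. [folklore] -/
theorem abs_streamObs_le {C : ℝ} (hC0 : 0 ≤ C) (hC : ∀ q, ‖fderiv ℝ P q‖ ≤ C) (ε : ℝ)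
    (z : Config (N + 1) (Fin 3) T3) (x₀ : T3) :
    |streamObs ε P z x₀| ≤ Fintype.card (Fin m ↪ Fin (N + 1)) * (C * ∑ k, ‖(z k).2‖) := by
  rw [streamObs_eq]
  refine (Finset.abs_sum_le_sum_abs _ _).trans ?_
  have hι : ∀ ι : Fin m ↪ Fin (N + 1),
      |(fderiv ℝ P (tupleData ε z x₀ ι)) (fun a => ((z (ι a)).2, 0))| ≤ C * ∑ k, ‖(z k).2‖ := by
    intro ι
    rw [← Real.norm_eq_abs]
    refine (ContinuousLinearMap.le_opNorm _ _).trans ?_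
    exact mul_le_mul (hC _) (norm_tupleVel_le z ι) (norm_nonneg _) hC0
  refine (Finset.sum_le_sum fun ι _ => hι ι).trans ?_
  rw [Finset.sum_const, Finset.card_univ, nsmul_eq_mul]

/-- **Time-Lipschitz bound of the window observable along a flight, uniform in the centre**:
`|winObs(S_s w) − winObs(S_{s'} w)| ≤ #{ι} ε⁻¹ sup‖DP‖ (Σ_k ‖v_k‖) |s − s'|` (mean value
inequality with `hasDerivAt_winObs_flight`). [folklore] -/
theorem abs_winObs_flight_sub_le (hε : 0 < ε) (hρ : ρ < 1 / 2) (hP : ContDiff ℝ 1 P)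
    (hmargin : ∀ q ∈ tsupport P, ∀ a, ε * ‖(q a).1‖ ≤ ρ) {C : ℝ} (hC0 : 0 ≤ C)
    (hC : ∀ q, ‖fderiv ℝ P q‖ ≤ C) (w : Config (N + 1) (Fin 3) T3) (x₀ : T3) (s s' : ℝ) :
    |winObs ε P (freeFlight (Torus.geometry (Fin 3)) s w) x₀ -
        winObs ε P (freeFlight (Torus.geometry (Fin 3)) s' w) x₀| ≤
      Fintype.card (Fin m ↪ Fin (N + 1)) * (ε⁻¹ * (C * ∑ k, ‖(w k).2‖)) * |s - s'| := by
  have hderiv := fun t : ℝ => hasDerivAt_winObs_flight hε hρ hP hmargin w x₀ t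
  have hbound : ∀ t ∈ (univ : Set ℝ),
      ‖ε⁻¹ * streamObs ε P (freeFlight (Torus.geometry (Fin 3)) t w) x₀‖ ≤
        Fintype.card (Fin m ↪ Fin (N + 1)) * (ε⁻¹ * (C * ∑ k, ‖(w k).2‖)) := by
    intro t _
    rw [norm_mul, norm_inv, Real.norm_eq_abs, abs_of_pos hε, Real.norm_eq_abs]
    have h := abs_streamObs_le hC0 hC ε (freeFlight (Torus.geometry (Fin 3)) t w) x₀
    simp only [freeFlight_apply] at h
    calc ε⁻¹ * |streamObs ε P (freeFlight (Torus.geometry (Fin 3)) t w) x₀|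
        ≤ ε⁻¹ * (Fintype.card (Fin m ↪ Fin (N + 1)) * (C * ∑ k, ‖(w k).2‖)) :=
          mul_le_mul_of_nonneg_left h (inv_nonneg.2 hε.le)
      _ = Fintype.card (Fin m ↪ Fin (N + 1)) * (ε⁻¹ * (C * ∑ k, ‖(w k).2‖)) := by ring
  have key := convex_univ.norm_image_sub_le_of_norm_hasDerivWithin_le
    (fun t _ => (hderiv t).hasDerivWithinAt) hbound (mem_univ s') (mem_univ s)
  rw [Real.norm_eq_abs, Real.norm_eq_abs] at key
  exact key

end Bounds

end Summit.AtomisticToContinuum.HydrodynamicLimit.Theorems.EvenStressEnskog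

end
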